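import Summits.QuantumFields.BalabanUV.T4Continuum.Support.NE7EtaBackgroundEnergyClassAllCutoffs
import Summits.QuantumFields.BalabanUV.T4Continuum.Support.NE7EtaBackgroundEnergyClassHolder
import HarnessLib

/-!
# NE7EtaBackgroundEnergyClassAllCutoffsHolder — route #1 of the NE7 crux (node U5), socket `h` AMENDMENT 5 (ROAD-G106 §4): gen 63's
# `NE7EtaBackgroundEnergyClassAllCutoffs` (NODE O's `hclose` without threshold and the END's four background-side binders with the selections'
# specification, on (H∃)ᴱ) RE-DERIVED FROM THE AMENDED SOCKET `h′` = (E) + (Lip₁ᶜ) + (Höl½ᶜ), rate base `θ^{18} = L⁻¹`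

Cell `pub-balaban`, rung (B)+1 sub-cell t4, lineage `b2b-balaban-t4-ne7-p1`, generation 106 (CRUX PROVER NE7 #1 = OWNER of BINDER row NE7).
Memo `t4/b2b-balaban-t4-ne7-p1-g106/ROAD-G106.md` §4.
WHAT ([folklore]; 0 def, 0 sorry).  **`hclose_of_hminE_allH`**, **`endTowers_spec_occCarriers_of_hminE_allH`** — statements of gen 63's `hclose_of_hminE_all` ∕
`endTowers_spec_occCarriers_of_hminE_all` VERBATIM except `hθ18 : θ^{18} = L⁻¹` and the socket `h′` (last conjunct (Höl½ᶜ) with `Λ_H`); conclusions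
VERBATIM (the END's `hUR`, `hURB`, `hURR`, `hwit` read `θ′ ≥ θ` as before).  Proofs = gen 63's over `NE7EtaBackgroundEnergyClassHolder.hclose_of_hminE_refH`.
HONEST FRAMING (page 1): bookkeeping ([folklore]); every analytic input is a HYPOTHESIS; all six functionals are ABSTRACT; nothing of NE3∕NE5∕NE9∕NE7
discharged; nothing of Bałaban's asserted as an axiom; spine count = dagwriter∕referees' call; FIXED FINITE T⁴, rung (B)+1 — NOT infinite volume,
NOT mass gap, NOT BetaPertH, NOT Clay.
-/

set_option autoImplicit false

open scoped BigOperators Matrix Matrix.Norms.L2Operator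
open Finset NormedSpace

namespace Summit.QuantumFields.BalabanUV.T4Continuum.NE7EtaBackgroundEnergyClassAllCutoffsHolder

open Literature.MathematicalPhysics.QuantumFieldTheory.Balaban1983to89
open B7Prop1Explicit B7Prop2Explicit MatrixLog
open T4AveragingDeficitWall hiding Site Plane Plaq Bond
open T4AveragingDeficitWallBoundary (periodBox IsPeriodicCfg)
open MinimalActionSandwich (IsMinimiser)
open MinimalActionRate (Regular sfClass regular_of_sup)
open AveragingDeficitTransport (norm_Ad_of_unitary)
open MinimalActionLevels (isUnitaryCfg_rescale_bavg)
open T4OutputRate (Carriers Functional NE9 NE5 LipBackground FadingMemory)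
open T4BoundaryCarrier (BFunctional atFl NE9Fl LipBackgroundFl NE5B)
open T4TowerRateComposition (PolyLipGrowth URateUpTo)
open T4CauchySum (InjectedRate)
open AveragingDeficitPeriodicCounting (IsPeriodicDir)
open AveragingDeficitTwoLevelPrep (twoLevelSmall)
open NE3EnergyShapes (residualScale IsUnitarySite IsPeriodicSite gaugeAct_one)
open NE3EnergyWeightedShapes (energyNormW)
open NE7EtaBackgroundCarrier
open TorusSmallFieldGlobalGauge (sectorConst)
open NE7EtaBackgroundReferenceWitness (gauge_refPair)
open NE7EtaBackgroundFamilyDocking (cr_nonneg)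
open NE7EtaBackgroundEndTowers (uRateUpTo_of_hclose_indexed uRateUpToFl_of_hclose)
open NE7EtaBackgroundAllCutoffs (plainReading_le_of_unitary)
open NE7EtaBackgroundEnergyClassHolder (hclose_of_hminE_refH)
open NE7EtaClosenessHolder (theta18_lt_one)

noncomputable section

variable {n : Type} [Fintype n] [DecidableEq n] [Nonempty n]

/-- **NODE O's `hclose` BINDER WITHOUT THRESHOLD, ON (H∃)ᴱ, FROM THE AMENDED SOCKET `h′`** — gen 63's `hclose_of_hminE_all` with `hθ18` and `h′`
(conclusion VERBATIM); as there, with `hmin` replaced by the energy-class `hminE` (`Regular 4 L N b g k`) and `gradConst 4 c ≤ g` by `0 ≤ g`: below the threshold `K₀` of `hclose_of_hminE_ref` the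
selections for `v ∈ dom`, `v ≠ v₁` are a crude minimiser pair from (H∃)ᴱ (run A level `K`, run B level `K+1`, `Regular`) in the trivial gauges,
read at distance `≤ 4·(L^K)² ≤ (4·(L^{K₀})²·θ^{−K₀})·θ^K`; from `K₀` on, the selections of `hclose_of_hminE_ref`.  CONCLUSION VERBATIM that of
p317084: selections and ONE `C₃ ≥ 0` with (a) gauge copies of a minimiser pair for the datum itself for EVERY `K` on `v ∈ dom ∧ v ≠ v₁`, (b) the
reference pair `(0, 1)` otherwise, (b′) `v₁` reads the reference pair at every cutoff, (c) `hclose`. [folklore] -/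
theorem hclose_of_hminE_allH {L N : ℕ} (hL : 2 ≤ L) (hN : 1 ≤ N) {θ : ℝ} (hθ : 0 < θ)
    (hθ18 : θ ^ 18 = ((L : ℝ))⁻¹) {ε b : ℝ} (hb : 0 ≤ b) (hbε : b ≤ ε)
    (hbs : 512 * (4 + 1) * (4 + 4) * (L : ℝ) ^ 2 * b ≤ 1)
    (hε1 : 16 * C0 4 * ε ≤ 3) (h2line : 2 * twoLevelSmall 4 L * ε ≤ (L : ℝ) ^ 2)
    {g C Λ₁ ΛH : ℝ} (hg : 0 ≤ g)
    {dom : Set (Site 4 → Fin 4 → (Matrix n n ℂ)ˣ)}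
    (hdom : ∀ v ∈ dom, ∀ w : Site 4 → (Matrix n n ℂ)ˣ, IsUnitarySite w → IsPeriodicSite w (N : ℤ) → gaugeAct w v ∈ dom)
    (hminE : ∀ V ∈ dom, ∀ k : ℕ, ∃ U, IsMinimiser 4 (sfClass 4 L N ε) L N k V U ∧ Regular 4 L N b g k U)
    (h : ∀ k : ℕ, 1 ≤ k → ∀ V ∈ dom, ∀ UA UB : Site 4 → Fin 4 → (Matrix n n ℂ)ˣ,
      IsMinimiser 4 (sfClass 4 L N ε) L N k V UA → IsMinimiser 4 (sfClass 4 L N ε) L N (k + 1) V UB →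
        Regular 4 L N b g (k + 1) UB →
        ∃ (u : Site 4 → (Matrix n n ℂ)ˣ) (Z : Site 4 → Fin 4 → Matrix n n ℂ),
          IsUnitarySite u ∧ IsPeriodicSite u ((N * L ^ k : ℕ) : ℤ) ∧
          IsSkewDir Z ∧ IsPeriodicDir Z ((N * L ^ k : ℕ) : ℤ) ∧
          gaugeAct u UA = vary (rescale L (bavg L UB)) Z 1 ∧
          energyNormW L k (rescale L (bavg L UB)) Z (periodBox (N * L ^ k)) ≤ C * residualScale 4 L N b g k ∧
          (∀ (κ : Fin 4) (x : Site 4) (μ : Fin 4),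
            ‖Ad (rescale L (bavg L UB) (x + e κ) μ) (Z (x + e μ) κ) - Z x κ‖ ≤ Λ₁ * (((L : ℝ)⁻¹) ^ k) ^ 2) ∧
          (∀ (κ μ : Fin 4) (y : Site 4) (j : ℕ),
            ‖Ad (((List.range j).map fun i : ℕ => rescale L (bavg L UB) (y + e κ + i • e μ) μ).prod)
                  (Ad (rescale L (bavg L UB) (y + j • e μ + e κ) μ) (Z (y + j • e μ + e μ) κ) - Z (y + j • e μ) κ)
                - (Ad (rescale L (bavg L UB) (y + e κ) μ) (Z (y + e μ) κ) - Z y κ)‖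
              ≤ ΛH * Real.sqrt (j : ℝ) * (((L : ℝ)⁻¹) ^ k) ^ 2 * Real.sqrt (((L : ℝ)⁻¹) ^ k)))
    (hsector : (Fintype.card n : ℝ) * (N : ℝ) ^ 2 * ε ≤ sectorConst n)
    (v₁ : Site 4 → Fin 4 → (Matrix n n ℂ)ˣ)
    (D : Type) (sc : D → ℕ) (dl : D → ℝ) (hdl : ∀ X, 0 ≤ dl X) :
    ∃ (uA : ℕ → (Site 4 → Fin 4 → (Matrix n n ℂ)ˣ) → (occCarriers n L N ε dom D sc dl hdl).BgA)
      (uB : ℕ → (Site 4 → Fin 4 → (Matrix n n ℂ)ˣ) → (occCarriers n L N ε dom D sc dl hdl).BgB) (C₃ : ℝ),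
      0 ≤ C₃ ∧
      (∀ K : ℕ, ∀ v ∈ dom, v ≠ v₁ → ∃ (UA UB : Site 4 → Fin 4 → (Matrix n n ℂ)ˣ) (wA wB : Site 4 → (Matrix n n ℂ)ˣ),
        IsMinimiser 4 (sfClass 4 L N ε) L N K v UA ∧ IsMinimiser 4 (sfClass 4 L N ε) L N (K + 1) v UB ∧
        Regular 4 L N b g (K + 1) UB ∧ IsUnitarySite wA ∧ IsPeriodicSite wA ((N * L ^ K : ℕ) : ℤ) ∧
        IsUnitarySite wB ∧ IsPeriodicSite wB ((N * L ^ (K + 1) : ℕ) : ℤ) ∧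
        (uA K v).1 = (K, gaugeAct wA UA) ∧ (uB K v).1 = (K, gaugeAct wB UB)) ∧
      (∀ (K : ℕ) (v : Site 4 → Fin 4 → (Matrix n n ℂ)ˣ), ¬ (v ∈ dom ∧ v ≠ v₁) →
        uA K v = ⟨((0 : ℕ), (1 : Site 4 → Fin 4 → (Matrix n n ℂ)ˣ)), one_mem_occA L N ε dom 0⟩ ∧
        uB K v = ⟨((0 : ℕ), (1 : Site 4 → Fin 4 → (Matrix n n ℂ)ˣ)), one_mem_occB L N ε dom 0⟩) ∧
      (∀ K : ℕ, uA K v₁ = ⟨((0 : ℕ), (1 : Site 4 → Fin 4 → (Matrix n n ℂ)ˣ)), one_mem_occA L N ε dom 0⟩ ∧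
        uB K v₁ = ⟨((0 : ℕ), (1 : Site 4 → Fin 4 → (Matrix n n ℂ)ˣ)), one_mem_occB L N ε dom 0⟩) ∧
      ∀ K : ℕ, ∀ v ∈ dom, (occCarriers n L N ε dom D sc dl hdl).gauge (uA K v)
          ((occCarriers n L N ε dom D sc dl hdl).transport (uB K v))
        ≤ C₃ * θ ^ K := by
  classical
  obtain ⟨uA, uB, K₀, C₃, hC₃, hspec, hoff, href, hclose⟩ := hclose_of_hminE_refH hL hN hθ hθ18 hb hbε hbs hε1 h2line hg hdom hminE h
    hsector v₁ D sc dl hdl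
  have hθ1 : θ < 1 := theta18_lt_one hL hθ18
  have hL1 : 1 ≤ L := le_trans (by norm_num) hL
  have hL1' : (1 : ℝ) ≤ L := by exact_mod_cast hL1
  -- crude minimiser pairs from (H∃)ᴱ at every cutoff, as total functions
  have hexA' : ∀ (K : ℕ) (v : Site 4 → Fin 4 → (Matrix n n ℂ)ˣ), ∃ UA : Site 4 → Fin 4 → (Matrix n n ℂ)ˣ,
      v ∈ dom → IsMinimiser 4 (sfClass 4 L N ε) L N K v UA := by
    intro K v
    by_cases hv : v ∈ dom
    · obtain ⟨U, hU, -⟩ := hminE v hv K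
      exact ⟨U, fun _ => hU⟩
    · exact ⟨1, fun h' => (hv h').elim⟩
  choose fA hfA using hexA'
  have hexB' : ∀ (K : ℕ) (v : Site 4 → Fin 4 → (Matrix n n ℂ)ˣ), ∃ UB : Site 4 → Fin 4 → (Matrix n n ℂ)ˣ,
      v ∈ dom → IsMinimiser 4 (sfClass 4 L N ε) L N (K + 1) v UB ∧ Regular 4 L N b g (K + 1) UB := by
    intro K v
    by_cases hv : v ∈ dom
    · obtain ⟨U, hU, hreg⟩ := hminE v hv (K + 1)
      exact ⟨U, fun _ => ⟨hU, hreg⟩⟩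
    · exact ⟨1, fun h' => (hv h').elim⟩
  choose fB hfB using hexB'
  -- the crude reading of such a pair
  have hcrude : ∀ (K : ℕ) (v : Site 4 → Fin 4 → (Matrix n n ℂ)ˣ), v ∈ dom →
      plainReading L N K (fA K v) (rescale L (bavg L (fB K v))) ≤ 4 * ((L : ℝ) ^ K) ^ 2 := by
    intro K v hv
    have hreg := (hfB K v hv).2
    have hLK1 : 1 ≤ ((L : ℝ) ^ (K + 1)) ^ 2 := one_le_pow₀ (one_le_pow₀ hL1')
    have hsmall : 512 * (4 + 1) * (4 + 4) * (L : ℝ) ^ 2 * (b / ((L : ℝ) ^ (K + 1)) ^ 2) ≤ 1 :=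
      le_trans (mul_le_mul_of_nonneg_left (div_le_self hb hLK1) (by positivity)) hbs
    exact plainReading_le_of_unitary hL1 N K (hfA K v hv).mem.1.1
      (isUnitaryCfg_rescale_bavg L hL1 hreg.unitary (by positivity) hsmall hreg.small)
  -- the enlarged constant
  set Ccr : ℝ := 4 * ((L : ℝ) ^ K₀) ^ 2 / θ ^ K₀ with hCcr
  have hθK₀ : 0 < θ ^ K₀ := pow_pos hθ K₀
  have hCcr0 : 0 ≤ Ccr := by positivity
  have hcrude' : ∀ K : ℕ, K < K₀ → 4 * ((L : ℝ) ^ K) ^ 2 ≤ (C₃ + Ccr) * θ ^ K := by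
    intro K hK
    have h1 : 4 * ((L : ℝ) ^ K) ^ 2 ≤ 4 * ((L : ℝ) ^ K₀) ^ 2 :=
      mul_le_mul_of_nonneg_left (pow_le_pow_left₀ (by positivity) (pow_le_pow_right₀ hL1' hK.le) 2) (by norm_num)
    have h2 : 4 * ((L : ℝ) ^ K₀) ^ 2 = Ccr * θ ^ K₀ := by rw [hCcr, div_mul_cancel₀ _ hθK₀.ne']
    have h3 : Ccr * θ ^ K₀ ≤ Ccr * θ ^ K := mul_le_mul_of_nonneg_left (pow_le_pow_of_le_one hθ.le hθ1.le hK.le) hCcr0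
    have h4 : Ccr * θ ^ K ≤ (C₃ + Ccr) * θ ^ K := mul_le_mul_of_nonneg_right (by linarith) (pow_nonneg hθ.le K)
    linarith
  -- the selections: crude pairs below `K₀` on `dom ∖ {v₁}`, the selections of `hclose_of_hminE_ref` otherwise
  refine ⟨fun K v => if hc : K < K₀ ∧ v ∈ dom ∧ v ≠ v₁ then
        ⟨(K, fA K v), minimiser_mem_occA L N ε dom K v hc.2.1 _ (hfA K v hc.2.1)⟩ else uA K v,
    fun K v => if hc : K < K₀ ∧ v ∈ dom ∧ v ≠ v₁ then
        ⟨(K, fB K v), minimiser_mem_occB L N ε dom K v hc.2.1 _ (hfB K v hc.2.1).1⟩ else uB K v,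
    C₃ + Ccr, add_nonneg hC₃ hCcr0, ?_, ?_, ?_, ?_⟩
  · -- (a) gauge copies of a minimiser pair for the datum itself, at EVERY cutoff
    intro K v hv hne
    by_cases hK : K < K₀
    · have hc : K < K₀ ∧ v ∈ dom ∧ v ≠ v₁ := ⟨hK, hv, hne⟩
      refine ⟨fA K v, fB K v, fun _ => 1, fun _ => 1, hfA K v hv, (hfB K v hv).1, (hfB K v hv).2,
        fun _ => (unitaryUnits (Matrix n n ℂ)).one_mem, fun _ _ => rfl,
        fun _ => (unitaryUnits (Matrix n n ℂ)).one_mem, fun _ _ => rfl, ?_, ?_⟩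
      · simp only [dif_pos hc]; rw [gaugeAct_one]
      · simp only [dif_pos hc]; rw [gaugeAct_one]
    · have hc : ¬ (K < K₀ ∧ v ∈ dom ∧ v ≠ v₁) := fun h' => hK h'.1
      obtain ⟨UA, UB, wA, wB, hA, hB, hreg, hwAu, hwAp, hwBu, hwBp, heA, heB⟩ := hspec K (not_lt.mp hK) v hv hne
      refine ⟨UA, UB, wA, wB, hA, hB, hreg, hwAu, hwAp, hwBu, hwBp, ?_, ?_⟩
      · simp only [dif_neg hc]; exact heA
      · simp only [dif_neg hc]; exact heB
  · -- (b) the reference pair at `v₁` and off `dom`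
    intro K v hKv
    have hc : ¬ (K < K₀ ∧ v ∈ dom ∧ v ≠ v₁) := fun h' => hKv h'.2
    have hKv' : ¬ (K₀ ≤ K ∧ v ∈ dom ∧ v ≠ v₁) := fun h' => hKv h'.2
    exact ⟨by simp only [dif_neg hc]; exact (hoff K v hKv').1, by simp only [dif_neg hc]; exact (hoff K v hKv').2⟩
  · -- (b′) the reference datum reads the reference pair at every cutoff
    intro K
    have hc : ¬ (K < K₀ ∧ v₁ ∈ dom ∧ v₁ ≠ v₁) := fun h' => h'.2.2 rfl
    exact ⟨by simp only [dif_neg hc]; exact (href K).1, by simp only [dif_neg hc]; exact (href K).2⟩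
  · -- (c) `hclose`
    intro K v hv
    by_cases hc : K < K₀ ∧ v ∈ dom ∧ v ≠ v₁
    · simp only [dif_pos hc]
      change levelGauge L N (K, fA K v) (K, rescale L (bavg L (fB K v))) ≤ _
      rw [levelGauge_same]
      exact (hcrude K v hv).trans (hcrude' K hc.1)
    · simp only [dif_neg hc]
      exact (hclose K v hv).trans (mul_le_mul_of_nonneg_right (by linarith) (pow_nonneg hθ.le K))

/-! ## §2 The END's four background-side binders WITH the selection's specification, on (H∃)ᴱ -/

/-- **THE END's `hUR`, `hURB`, `hURR`, (F′) `hwit` AND THE SPECIFICATION OF THE SAME SELECTIONS, ON THE BOUNDARY CARRIER OVER `occCarriers`,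
ON (H∃)ᴱ, FROM THE AMENDED SOCKET `h′`** (`hθ18`; ANY pending-field data `Fl`, `admFl`) — `NE7EtaBackgroundAllCutoffs.endTowers_spec_occCarriers_of_hmin_all` (p317816) with `hmin`
replaced by the energy-class `hminE` and `gradConst 4 c ≤ g` by `0 ≤ g`; hypotheses otherwise and CONCLUSION VERBATIM: (a) for EVERY cutoff `K`
and every `v ∈ dom`, `v ≠ v₁`, `(uA K v).1 = (K, wA·UA)`, `(uB K v).1 = (K, wB·UB)` for a minimiser pair `UA` (level `K`), `UB` (level `K+1`,
`Regular`) of the datum `v` and unitary periodic gauges `wA`, `wB`; (b) the tag-`0` reference pair `(0, 1)` at `v₁` and off `dom`; then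
`Cr, EB₀, CrR ≥ 0` and the END's `hUR` (l.92), `hURB` (l.94), `hURR` (l.96), `hwit` (l.132) VERBATIM with `oneA := (0,1)`, `oneB := (0,1)`,
`gA K := gtab K`, `gB K := gtab (K+1) (·+1)`, `Adm := dom`.  HONEST: every analytic input is a HYPOTHESIS; all six functionals are ABSTRACT
(X-A2); nothing of NE3∕NE5∕NE9∕NE7 discharged. [folklore] -/
theorem endTowers_spec_occCarriers_of_hminE_allH {L N : ℕ} (hL : 2 ≤ L) (hN : 1 ≤ N) {θ : ℝ} (hθ : 0 < θ)
    (hθ18 : θ ^ 18 = ((L : ℝ))⁻¹) {ε b : ℝ} (hb : 0 ≤ b) (hbε : b ≤ ε)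
    (hbs : 512 * (4 + 1) * (4 + 4) * (L : ℝ) ^ 2 * b ≤ 1)
    (hε1 : 16 * C0 4 * ε ≤ 3) (h2line : 2 * twoLevelSmall 4 L * ε ≤ (L : ℝ) ^ 2)
    {g C Λ₁ ΛH : ℝ} (hg : 0 ≤ g)
    {dom : Set (Site 4 → Fin 4 → (Matrix n n ℂ)ˣ)}
    (hdom : ∀ v ∈ dom, ∀ w : Site 4 → (Matrix n n ℂ)ˣ, IsUnitarySite w → IsPeriodicSite w (N : ℤ) → gaugeAct w v ∈ dom)
    (hminE : ∀ V ∈ dom, ∀ k : ℕ, ∃ U, IsMinimiser 4 (sfClass 4 L N ε) L N k V U ∧ Regular 4 L N b g k U)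
    (h : ∀ k : ℕ, 1 ≤ k → ∀ V ∈ dom, ∀ UA UB : Site 4 → Fin 4 → (Matrix n n ℂ)ˣ,
      IsMinimiser 4 (sfClass 4 L N ε) L N k V UA → IsMinimiser 4 (sfClass 4 L N ε) L N (k + 1) V UB →
        Regular 4 L N b g (k + 1) UB →
        ∃ (u : Site 4 → (Matrix n n ℂ)ˣ) (Z : Site 4 → Fin 4 → Matrix n n ℂ),
          IsUnitarySite u ∧ IsPeriodicSite u ((N * L ^ k : ℕ) : ℤ) ∧
          IsSkewDir Z ∧ IsPeriodicDir Z ((N * L ^ k : ℕ) : ℤ) ∧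
          gaugeAct u UA = vary (rescale L (bavg L UB)) Z 1 ∧
          energyNormW L k (rescale L (bavg L UB)) Z (periodBox (N * L ^ k)) ≤ C * residualScale 4 L N b g k ∧
          (∀ (κ : Fin 4) (x : Site 4) (μ : Fin 4),
            ‖Ad (rescale L (bavg L UB) (x + e κ) μ) (Z (x + e μ) κ) - Z x κ‖ ≤ Λ₁ * (((L : ℝ)⁻¹) ^ k) ^ 2) ∧
          (∀ (κ μ : Fin 4) (y : Site 4) (j : ℕ),
            ‖Ad (((List.range j).map fun i : ℕ => rescale L (bavg L UB) (y + e κ + i • e μ) μ).prod)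
                  (Ad (rescale L (bavg L UB) (y + j • e μ + e κ) μ) (Z (y + j • e μ + e μ) κ) - Z (y + j • e μ) κ)
                - (Ad (rescale L (bavg L UB) (y + e κ) μ) (Z (y + e μ) κ) - Z y κ)‖
              ≤ ΛH * Real.sqrt (j : ℝ) * (((L : ℝ)⁻¹) ^ k) ^ 2 * Real.sqrt (((L : ℝ)⁻¹) ^ k)))
    (hsector : (Fintype.card n : ℝ) * (N : ℝ) ^ 2 * ε ≤ sectorConst n)
    {v₁ : Site 4 → Fin 4 → (Matrix n n ℂ)ˣ} (hv₁ : v₁ ∈ dom)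
    (D : Type) (sc : D → ℕ) (dl : D → ℝ) (hdl : ∀ X, 0 ≤ dl X) (Fl : Type) (admFl : Set Fl)
    -- the shared data: window, decay, history moduli, node U2's output on the printed box, the common rate
    {W : Set (ℕ → ℝ)} {κ C₉ ω θc Cd γg θ' : ℝ} {Λ : ℕ → ℕ → ℝ} {gtab : ℕ → ℕ → ℝ}
    (hΛ : FadingMemory C₉ ω Λ) (hω : 0 ≤ ω)
    (hinj : InjectedRate Cd 0 θc (fun K j => T4CouplingMatching.disc (gtab K) (gtab (K + 1)) j)) (hCd : 0 ≤ Cd)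
    (hθc : 0 ≤ θc) (hbox : ∀ K i, i ≤ K → 0 < gtab K i ∧ gtab K i ≤ γg)
    (hgA : ∀ K, gtab K ∈ W) (hgB : ∀ K, (fun i => gtab (K + 1) (i + 1)) ∈ W)
    (hθ' : max ω θc < θ') (hθθ' : θ ≤ θ')
    -- E-kind: node U3's shapes for `EA`, `EB`
    {EA : Functional ({ toCarriers := occCarriers n L N ε dom D sc dl hdl, Fl := Fl, admFl := admFl } :
        T4BoundaryCarrier.Carriers).toCarriers (occCarriers n L N ε dom D sc dl hdl).BgA}
    {EB : Functional ({ toCarriers := occCarriers n L N ε dom D sc dl hdl, Fl := Fl, admFl := admFl } :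
        T4BoundaryCarrier.Carriers).toCarriers (occCarriers n L N ε dom D sc dl hdl).BgB}
    {θ₅ C₅ P : ℝ} {q : ℕ} {CU : (ℕ → ℝ) → ℕ → ℝ}
    (h9 : NE9 EA W κ Λ) (hU : LipBackground EA W κ CU) (hG : PolyLipGrowth CU gtab P q) (hP : 0 ≤ P)
    (h5 : NE5 EA EB W κ θ₅ C₅) (hθ₅ : 0 ≤ θ₅) (hC₅ : 0 ≤ C₅) (hθ₅' : θ₅ ≤ θ')
    -- boundary kind: node U3.B's shapes for `BA`, `BB`
    {BA : BFunctional ({ toCarriers := occCarriers n L N ε dom D sc dl hdl, Fl := Fl, admFl := admFl } : T4BoundaryCarrier.Carriers)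
        (occCarriers n L N ε dom D sc dl hdl).BgA}
    {BB : BFunctional ({ toCarriers := occCarriers n L N ε dom D sc dl hdl, Fl := Fl, admFl := admFl } : T4BoundaryCarrier.Carriers)
        (occCarriers n L N ε dom D sc dl hdl).BgB}
    {θ₅B C₅B PB : ℝ} {qB : ℕ} {CUB : (ℕ → ℝ) → ℕ → ℝ}
    (h9B : NE9Fl BA W κ Λ) (hUB : LipBackgroundFl BA W κ CUB) (hGB : PolyLipGrowth CUB gtab PB qB) (hPB : 0 ≤ PB)
    (h5B : NE5B BA BB W κ θ₅B C₅B) (hθ₅B : 0 ≤ θ₅B) (hC₅B : 0 ≤ C₅B) (hθ₅B' : θ₅B ≤ θ')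
    -- 𝐑-kind: node U3's shapes for `RA`, `RB`
    {RA : Functional ({ toCarriers := occCarriers n L N ε dom D sc dl hdl, Fl := Fl, admFl := admFl } :
        T4BoundaryCarrier.Carriers).toCarriers (occCarriers n L N ε dom D sc dl hdl).BgA}
    {RB : Functional ({ toCarriers := occCarriers n L N ε dom D sc dl hdl, Fl := Fl, admFl := admFl } :
        T4BoundaryCarrier.Carriers).toCarriers (occCarriers n L N ε dom D sc dl hdl).BgB}
    {θ₅R C₅R PR : ℝ} {qR : ℕ} {CUR : (ℕ → ℝ) → ℕ → ℝ}
    (h9R : NE9 RA W κ Λ) (hUR' : LipBackground RA W κ CUR) (hGR : PolyLipGrowth CUR gtab PR qR) (hPR : 0 ≤ PR)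
    (h5R : NE5 RA RB W κ θ₅R C₅R) (hθ₅R : 0 ≤ θ₅R) (hC₅R : 0 ≤ C₅R) (hθ₅R' : θ₅R ≤ θ') :
    ∃ (uA : ℕ → (Site 4 → Fin 4 → (Matrix n n ℂ)ˣ) → (occCarriers n L N ε dom D sc dl hdl).BgA)
      (uB : ℕ → (Site 4 → Fin 4 → (Matrix n n ℂ)ˣ) → (occCarriers n L N ε dom D sc dl hdl).BgB) (Cr EB₀ CrR : ℝ),
      -- (a) the specification: gauge copies of a minimiser pair for the datum itself, at EVERY cutoff
      (∀ K : ℕ, ∀ v ∈ dom, v ≠ v₁ → ∃ (UA UB : Site 4 → Fin 4 → (Matrix n n ℂ)ˣ) (wA wB : Site 4 → (Matrix n n ℂ)ˣ),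
        IsMinimiser 4 (sfClass 4 L N ε) L N K v UA ∧ IsMinimiser 4 (sfClass 4 L N ε) L N (K + 1) v UB ∧
        Regular 4 L N b g (K + 1) UB ∧ IsUnitarySite wA ∧ IsPeriodicSite wA ((N * L ^ K : ℕ) : ℤ) ∧
        IsUnitarySite wB ∧ IsPeriodicSite wB ((N * L ^ (K + 1) : ℕ) : ℤ) ∧
        (uA K v).1 = (K, gaugeAct wA UA) ∧ (uB K v).1 = (K, gaugeAct wB UB)) ∧
      -- (b) the reference pair at `v₁` and off `dom`
      (∀ (K : ℕ) (v : Site 4 → Fin 4 → (Matrix n n ℂ)ˣ), ¬ (v ∈ dom ∧ v ≠ v₁) →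
        uA K v = ⟨((0 : ℕ), (1 : Site 4 → Fin 4 → (Matrix n n ℂ)ˣ)), one_mem_occA L N ε dom 0⟩ ∧
        uB K v = ⟨((0 : ℕ), (1 : Site 4 → Fin 4 → (Matrix n n ℂ)ˣ)), one_mem_occB L N ε dom 0⟩) ∧
      0 ≤ Cr ∧ 0 ≤ EB₀ ∧ 0 ≤ CrR ∧
      -- `hUR` (l.92)
      (∀ K : ℕ, URateUpTo K EA EB (gtab K) (fun i => gtab (K + 1) (i + 1)) (uA K) (uB K) dom Cr θ' κ) ∧
      -- `hURB` (l.94)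
      (∀ bfl ∈ admFl, ∀ K : ℕ,
        URateUpTo K (atFl BA bfl) (atFl BB bfl) (gtab K) (fun i => gtab (K + 1) (i + 1)) (uA K) (uB K) dom EB₀ θ' κ) ∧
      -- `hURR` (l.96)
      (∀ K : ℕ, URateUpTo K RA RB (gtab K) (fun i => gtab (K + 1) (i + 1)) (uA K) (uB K) dom CrR θ' κ) ∧
      -- `hwit` (l.132), `oneA := (0, 1)`, `oneB := (0, 1)`, the witness being `v₁` at every cutoff
      (∀ K : ℕ, ∃ v ∈ dom, uA K v = ⟨((0 : ℕ), (1 : Site 4 → Fin 4 → (Matrix n n ℂ)ˣ)), one_mem_occA L N ε dom 0⟩ ∧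
        uB K v = ⟨((0 : ℕ), (1 : Site 4 → Fin 4 → (Matrix n n ℂ)ˣ)), one_mem_occB L N ε dom 0⟩) := by
  obtain ⟨uA, uB, C₃, hC₃, hspec, hoff, href, hclose⟩ := hclose_of_hminE_allH hL hN hθ hθ18 hb hbε hbs hε1 h2line hg hdom hminE h
    hsector v₁ D sc dl hdl
  have hθ1 : θ < 1 := theta18_lt_one hL hθ18
  -- E-kind: the one-member family
  obtain ⟨a, ha, hE⟩ := uRateUpTo_of_hclose_indexed (Car := occCarriers n L N ε dom D sc dl hdl) (Set.univ : Set Unit)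
    (EAj := fun _ => EA) (EBj := fun _ => EB) (fun _ _ => h9) hΛ hω (fun _ _ => hU) hG hP (fun _ _ => h5) hθ₅ hC₅ hclose hC₃
    hθ.le hθ1 hinj hCd hθc hbox hgA hgB hθ' hθ₅' hθθ'
  -- boundary kind: every admissible pending field, one constant
  obtain ⟨aB, haB, hB⟩ := uRateUpToFl_of_hclose
    (C := ({ toCarriers := occCarriers n L N ε dom D sc dl hdl, Fl := Fl, admFl := admFl } : T4BoundaryCarrier.Carriers))
    h9B hΛ hω hUB hGB hPB h5B hθ₅B hC₅B hclose hC₃ hθ.le hθ1 hinj hCd hθc hbox hgA hgB hθ' hθ₅B' hθθ'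
  -- 𝐑-kind
  obtain ⟨aR, haR, hR⟩ := uRateUpTo_of_hclose_indexed (Car := occCarriers n L N ε dom D sc dl hdl) (Set.univ : Set Unit)
    (EAj := fun _ => RA) (EBj := fun _ => RB) (fun _ _ => h9R) hΛ hω (fun _ _ => hUR') hGR hPR (fun _ _ => h5R) hθ₅R hC₅R hclose
    hC₃ hθ.le hθ1 hinj hCd hθc hbox hgA hgB hθ' hθ₅R' hθθ'
  exact ⟨uA, uB, _, _, _, hspec, hoff, cr_nonneg hΛ hω hCd hbox hC₅ ha hθ', cr_nonneg hΛ hω hCd hbox hC₅B haB hθ',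
    cr_nonneg hΛ hω hCd hbox hC₅R haR hθ', fun K => hE K () (Set.mem_univ _), hB, fun K => hR K () (Set.mem_univ _),
    fun K => ⟨v₁, hv₁, (href K).1, (href K).2⟩⟩

end

end Summit.QuantumFields.BalabanUV.T4Continuum.NE7EtaBackgroundEnergyClassAllCutoffsHolder
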